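import Summits.CriticalPhenomena.PercolationContinuityZ3.Theorems.PercNearOneGluingNoHeavyQuantFarRelayRowComb
import HarnessLib

/-!
# QUANT lane R8: FAR at every layer on combs whose distinguished END relay is not the least likely one
# (caterpillars read from their last leg)

builds on p205010 (kernel theorem, internal audit signed; external expert review pending)

Support file (`--supports stmt-CriticalPhenomena-4575`), QUANT lane seat prim-quant-p1 (gen 6), rung R8 of
`run/shared/lean/prim/quant/LADDER.md`; memo `P1-SURPLUS.md` §17.7.  Theorems only; no sorries; standard axioms.

`Quant.farTreeRow_comb` (`…QuantFarTreeComb.lean`) needs the comb to be read from a LEAST LIKELY relay `a`.  The sojourn lemma actually needs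
less: in `P(N ≥ j+1) = Σ_k w_k p_k · PB[p, k] j + x · PB[p, K] j ≥ θ · Σ_m PB[p, m] j` only `θ = min_b P(b reached)` is used, and the sojourn
hypothesis `p 0 + Σ_k p k > 2j` follows from `E N > 2j` as soon as `x = P(a reached) ≤ p 0` = the PRIVATE-path probability of the top hair.
So a comb may be read from ANY end relay `a` that is no heavier than the private part of the hair attached highest on its chain — e.g. a caterpillar
read from its LAST leg whenever that leg is no likelier than the first leg's private path (automatic when the last leg is an argmin).

* `Quant.CountDP.sojourn_weighted_min` — the all-layer singles chain inequality with a separate floor `θ ≤ x`, `θ ≤ w k p k`, and `x ≤ p 0`.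
* `Quant.exists_enum_mono_first` — selection sort with a prescribed first element of minimal key.
* `Quant.farTreeRow_comb_end` — gate coordinates: forest axioms, `A ∋ a`, a top hair `b₀ ∈ A ∖ a` (`P b₀ ∩ P a ⊆ P b ∩ P a` on `A ∖ a`) with
  `∏_{P a} q ≤ ∏_{P b₀ ∖ P a} q`, a least likely relay `b⋆ ∈ A`, the comb condition w.r.t. `a`, `2j < Σ_A ∏_{P b} q`, `1 − ∏_{P b} q ≤ t` on `A`
  ⟹ `P(#{b ∈ A reached} ≤ j) ≤ t` (every layer `j`).
* `Quant.farRelayRow_tree_comb_end` — the same in the route vocabulary (tree-supported weights on `Sym2 (Fin n)`, `o ∉ A`), via the tree transfer.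
[this work]
-/

noncomputable section

namespace Summit.CriticalPhenomena.PercolationContinuityZ3.Theorems

namespace Quant

open Finset MeasureTheory
open Literature.Probability.LatticeModels
open Literature.Probability.Percolation
open scoped Classical

/-- `PB[p, m] b` = probability that exactly `b` of the first `m` independent trials succeed (recursion on `m`, as in `…QuantCountDP.lean`). -/
local notation3 "PB[" p ", " m "]" =>
  (Nat.rec (motive := fun _ => ℕ → ℝ) (fun b => if b = 0 then (1 : ℝ) else 0)
    (fun n f b => (p : ℕ → ℝ) n * (if b = 0 then (0 : ℝ) else f (b - 1)) + (1 - (p : ℕ → ℝ) n) * f b) (m : ℕ))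

namespace CountDP

/-- **All-layer singles chain inequality with a separate floor.**  `0 ≤ θ ≤ x`, `θ ≤ w k · p k`, `w k ≤ 1` (`k < K`), `x ≤ p 0` and
`x + Σ_{k<K} w k p k > 2j` (`j ≥ 1`) give `θ ≤ Σ_{k<K} w k p k · PB[p, k] j + x · PB[p, K] j`. [this work] -/
theorem sojourn_weighted_min (p : ℕ → ℝ) (hp : ∀ k, 0 ≤ p k ∧ p k ≤ 1) (w : ℕ → ℝ) (x θ : ℝ) (K j : ℕ) (hj : 1 ≤ j)
    (hθ0 : 0 ≤ θ) (hθx : θ ≤ x) (hw1 : ∀ k, k < K → w k ≤ 1) (hwθ : ∀ k, k < K → θ ≤ w k * p k)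
    (hxp : x ≤ p 0) (hmean : (2 * j : ℝ) < x + ∑ k ∈ Finset.range K, w k * p k) :
    θ ≤ ∑ k ∈ Finset.range K, w k * p k * PB[p, k] j + x * PB[p, K] j := by
  have hwp_le : ∀ k, k < K → w k * p k ≤ p k := by
    intro k hk
    have := hw1 k hk
    nlinarith [(hp k).1]
  have hmean' : (2 * j : ℝ) < p 0 + ∑ k ∈ Finset.range K, p k := by
    have h1 : ∑ k ∈ Finset.range K, w k * p k ≤ ∑ k ∈ Finset.range K, p k :=
      Finset.sum_le_sum fun k hk => hwp_le k (Finset.mem_range.1 hk)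
    linarith
  have hG := sojourn_ge_one p hp K j hj hmean'
  have hdom : ∑ k ∈ Finset.range K, θ * PB[p, k] j ≤ ∑ k ∈ Finset.range K, w k * p k * PB[p, k] j :=
    Finset.sum_le_sum fun k hk => mul_le_mul_of_nonneg_right (hwθ k (Finset.mem_range.1 hk)) (PB_nonneg p hp k j)
  rw [← Finset.mul_sum] at hdom
  rw [Finset.sum_range_succ] at hG
  have hKnn := PB_nonneg p hp K j
  have hsum_nn : 0 ≤ ∑ k ∈ Finset.range K, PB[p, k] j := Finset.sum_nonneg fun k _ => PB_nonneg p hp k j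
  nlinarith [mul_le_mul_of_nonneg_right hθx hKnn]

end CountDP

variable {ι : Type*}

/-- **Selection sort with a prescribed first element.**  If `y₀ ∈ S` has minimal key, `S` (of cardinality `n + 1`) has a key-nondecreasing
enumeration starting at `y₀`. [folklore] -/
theorem exists_enum_mono_first [DecidableEq ι] (f : ι → ℕ) (S : Finset ι) (y₀ : ι) (hy₀ : y₀ ∈ S) (hmin : ∀ y ∈ S, f y₀ ≤ f y)
    (n : ℕ) (hS : S.card = n + 1) :
    ∃ b : ℕ → ι, b 0 = y₀ ∧ (∀ k, k < n + 1 → b k ∈ S) ∧ (∀ k k', k < n + 1 → k' < n + 1 → b k = b k' → k = k') ∧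
      (∀ y ∈ S, ∃ k, k < n + 1 ∧ b k = y) ∧ (∀ k k', k ≤ k' → k' < n + 1 → f (b k) ≤ f (b k')) := by
  have hcard : (S.erase y₀).card = n := by rw [Finset.card_erase_of_mem hy₀, hS]; rfl
  obtain ⟨b', hb'mem, hb'inj, hb'cov, hb'mono⟩ := exists_enum_mono f y₀ n (S.erase y₀) hcard
  refine ⟨fun k => if k = 0 then y₀ else b' (k - 1), by simp, ?_, ?_, ?_, ?_⟩
  · intro k hk
    by_cases hk0 : k = 0
    · simp only [hk0, if_true]; exact hy₀
    · simp only [hk0, if_false]; exact Finset.mem_of_mem_erase (hb'mem (k - 1) (by omega))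
  · intro k k' hk hk' h
    by_cases hk0 : k = 0 <;> by_cases hk0' : k' = 0
    · omega
    · simp only [hk0, if_true, hk0', if_false] at h
      have := hb'mem (k' - 1) (by omega)
      rw [← h] at this
      exact absurd this (Finset.notMem_erase y₀ S)
    · simp only [hk0, if_false, hk0', if_true] at h
      have := hb'mem (k - 1) (by omega)
      rw [h] at this
      exact absurd this (Finset.notMem_erase y₀ S)
    · simp only [hk0, if_false, hk0'] at h
      have := hb'inj (k - 1) (k' - 1) (by omega) (by omega) h
      omega
  · intro y hy
    by_cases hyy : y = y₀
    · exact ⟨0, by omega, by simp [hyy]⟩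
    · obtain ⟨k, hk, hky⟩ := hb'cov y (Finset.mem_erase.2 ⟨hyy, hy⟩)
      refine ⟨k + 1, by omega, ?_⟩
      simp only [Nat.add_one_ne_zero, if_false, Nat.add_sub_cancel]
      exact hky
  · intro k k' hkk' hk'
    by_cases hk0 : k = 0
    · simp only [hk0, if_true]
      by_cases hk0' : k' = 0
      · simp only [hk0', if_true]; exact le_rfl
      · simp only [hk0', if_false]
        exact hmin _ (Finset.mem_of_mem_erase (hb'mem (k' - 1) (by omega)))
    · have hk0' : k' ≠ 0 := by omega
      simp only [hk0, hk0', if_false]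
      exact hb'mono (k - 1) (k' - 1) (by omega) (by omega)

/-- **FAR at every layer on a comb read from an end relay.**  Gate coordinates (forest axioms as in `Quant.FarTreeRow`): `A ∋ a`; the other relays hang
off `a`'s chain by pairwise disjoint private parts (`P b ∩ P b' ⊆ P a`); `b₀ ∈ A ∖ a` is a TOP hair (`P b₀ ∩ P a ⊆ P b ∩ P a` on `A ∖ a`) whose private
part is at least as likely as `a` (`∏_{P a} q ≤ ∏_{P b₀ ∖ P a} q`); `b⋆ ∈ A` is a least likely relay.  Then `2j < Σ_A ∏_{P b} q` and `1 − ∏_{P b} q ≤ t`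
on `A` imply `P(#{b ∈ A : ↑(P b) ⊆ ω} ≤ j) ≤ t`. [this work] -/
theorem farTreeRow_comb_end (m : ℕ) (P : Fin m → Finset (Fin m))
    (h2 : ∀ x, ∀ y ∈ P x, P y ⊆ P x) (h3 : ∀ x, ∀ y ∈ P x, ∀ z ∈ P x, y ∈ P z ∨ z ∈ P y)
    (q : Fin m → unitInterval) (A : Finset (Fin m)) (j : ℕ) (t : ℝ) (a : Fin m) (ha : a ∈ A)
    (b₀ : Fin m) (hb₀ : b₀ ∈ A) (hb₀a : b₀ ≠ a) (htop : ∀ b ∈ A, b ≠ a → P b₀ ∩ P a ⊆ P b ∩ P a)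
    (hap : ∏ y ∈ P a, (q y : ℝ) ≤ ∏ y ∈ P b₀ \ P a, (q y : ℝ))
    (bm : Fin m) (hbm : bm ∈ A) (hθ : ∀ b ∈ A, ∏ y ∈ P bm, (q y : ℝ) ≤ ∏ y ∈ P b, (q y : ℝ))
    (hcomb : ∀ b ∈ A, ∀ b' ∈ A, b ≠ a → b' ≠ a → b ≠ b' → P b ∩ P b' ⊆ P a)
    (hEN : (2 * j : ℝ) < ∑ b ∈ A, ∏ y ∈ P b, (q y : ℝ))
    (ht : ∀ b ∈ A, 1 - ∏ y ∈ P b, (q y : ℝ) ≤ t) :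
    (prodBernoulli q).real {ω : Set (Fin m) | (A.filter fun b => ((P b : Finset (Fin m)) : Set (Fin m)) ⊆ ω).card ≤ j} ≤ t := by
  set μ := prodBernoulli q with hμ
  have hmeas : ∀ T : Set (Set (Fin m)), MeasurableSet T := fun T => (Set.toFinite T).measurableSet
  have hq0 : ∀ y, (0 : ℝ) ≤ q y := fun y => (q y).2.1
  have hq1 : ∀ y, (q y : ℝ) ≤ 1 := fun y => (q y).2.2
  have hprod01 : ∀ s : Finset (Fin m), 0 ≤ ∏ y ∈ s, (q y : ℝ) ∧ ∏ y ∈ s, (q y : ℝ) ≤ 1 := fun s =>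
    ⟨Finset.prod_nonneg fun y _ => hq0 y, Finset.prod_le_one (fun y _ => hq0 y) fun y _ => hq1 y⟩
  set x : ℝ := ∏ y ∈ P a, (q y : ℝ) with hx
  set θ : ℝ := ∏ y ∈ P bm, (q y : ℝ) with hθdef
  suffices hge : θ ≤ μ.real {ω : Set (Fin m) | j + 1 ≤ (A.filter fun b => ((P b : Finset (Fin m)) : Set (Fin m)) ⊆ ω).card} by
    have hcompl : {ω : Set (Fin m) | (A.filter fun b => ((P b : Finset (Fin m)) : Set (Fin m)) ⊆ ω).card ≤ j} =
        {ω : Set (Fin m) | j + 1 ≤ (A.filter fun b => ((P b : Finset (Fin m)) : Set (Fin m)) ⊆ ω).card}ᶜ := by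
      ext ω; simp only [Set.mem_setOf_eq, Set.mem_compl_iff, not_le]; omega
    rw [hcompl, probReal_compl_eq_one_sub (hmeas _)]
    linarith [ht bm hbm]
  rcases Nat.eq_zero_or_pos j with hj0 | hjpos
  · subst hj0
    have hθle : θ ≤ μ.real {ω : Set (Fin m) | ((P bm : Finset (Fin m)) : Set (Fin m)) ⊆ ω} := by
      rw [prodBernoulli_real_subset]
    refine hθle.trans (measureReal_mono ?_ (measure_ne_top _ _))
    intro ω hω
    simp only [Set.mem_setOf_eq, zero_add] at hω ⊢
    exact Finset.card_pos.2 ⟨bm, Finset.mem_filter.2 ⟨hbm, hω⟩⟩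
  -- enumerate the hairs root-first, starting with the top hair `b₀`
  set S : Finset (Fin m) := A.erase a with hS
  have hb₀S : b₀ ∈ S := Finset.mem_erase.2 ⟨hb₀a, hb₀⟩
  have hSpos : S.card = (S.card - 1) + 1 := by
    have := Finset.card_pos.2 ⟨b₀, hb₀S⟩; omega
  obtain ⟨b, hb0, hbmem, hbinj, hbcov, hbmono⟩ := exists_enum_mono_first (fun y => (P y ∩ P a).card) S b₀ hb₀S
    (fun y hy => Finset.card_le_card (htop y (Finset.mem_of_mem_erase hy) (Finset.mem_erase.1 hy).1)) (S.card - 1) hSpos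
  set K := S.card with hK
  rw [← hSpos] at hbmem hbinj hbcov hbmono
  have hb : ∀ k, k < K → b k ∈ A ∧ b k ≠ a := fun k hk =>
    ⟨Finset.mem_of_mem_erase (hbmem k hk), (Finset.mem_erase.1 (hbmem k hk)).1⟩
  have hcover : ∀ y ∈ A, y ≠ a → ∃ k, k < K ∧ b k = y := fun y hy hya => hbcov y (Finset.mem_erase.2 ⟨hya, hy⟩)
  have hmono : ∀ k k', k ≤ k' → k' < K → P (b k) ∩ P a ⊆ P (b k') ∩ P a := fun k k' hkk' hk' =>
    subset_of_nested_of_card_le (comb_downsets_nested P h2 h3 a (b k) (b k')) (hbmono k k' hkk' hk')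
  have hcomb' : ∀ k k', k < K → k' < K → k ≠ k' → P (b k) ∩ P (b k') ⊆ P a := fun k k' hk hk' hne =>
    hcomb (b k) (hb k hk).1 (b k') (hb k' hk').1 (hb k hk).2 (hb k' hk').2 fun h => hne (hbinj k k' hk hk' h)
  set p : ℕ → ℝ := fun k => ∏ y ∈ P (b k) \ P a, (q y : ℝ) with hp
  set w : ℕ → ℝ := fun k => ∏ y ∈ P (b k) ∩ P a, (q y : ℝ) with hw
  have hcount := comb_count_eq P q a x hx K A b p w ha hb hbinj hcover hmono hcomb' (fun k => rfl) (fun k => rfl)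
    (j + 1) (by omega)
  rw [Nat.add_sub_cancel] at hcount
  rw [hcount]
  have hp01 : ∀ k, 0 ≤ p k ∧ p k ≤ 1 := fun k => hprod01 _
  have hwp : ∀ k, w k * p k = ∏ y ∈ P (b k), (q y : ℝ) := by
    intro k
    rw [hw, hp]
    simp only
    rw [← Finset.prod_union (Finset.disjoint_sdiff_inter (P (b k)) (P a)).symm]
    congr 1
    ext y; simp only [Finset.mem_union, Finset.mem_inter, Finset.mem_sdiff]; tauto
  have hxp : x ≤ p 0 := by
    have : p 0 = ∏ y ∈ P b₀ \ P a, (q y : ℝ) := by rw [hp]; simp only [hb0]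
    rw [this]; exact hap
  refine CountDP.sojourn_weighted_min p hp01 w x θ K j hjpos (hprod01 _).1 (hθ a ha) (fun k _ => (hprod01 _).2)
    (fun k hk => by rw [hwp]; exact hθ (b k) (hb k hk).1) hxp ?_
  have himage : S = (Finset.range K).image b := by
    ext y
    constructor
    · intro hy
      obtain ⟨k, hk, rfl⟩ := hbcov y hy
      exact Finset.mem_image.2 ⟨k, Finset.mem_range.2 hk, rfl⟩
    · intro hy
      obtain ⟨k, hk, rfl⟩ := Finset.mem_image.1 hy
      exact hbmem k (Finset.mem_range.1 hk)
  have hsum : ∑ y ∈ A, ∏ z ∈ P y, (q z : ℝ) = x + ∑ k ∈ Finset.range K, w k * p k := by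
    rw [← Finset.add_sum_erase A _ ha, ← hS, himage, Finset.sum_image fun k hk k' hk' h =>
      hbinj k k' (Finset.mem_range.1 hk) (Finset.mem_range.1 hk') h]
    simp only [hwp]
    rw [hx]
  rw [← hsum]
  exact hEN

variable {n : ℕ}

/-- **FAR at every layer on a comb read from an end relay — route vocabulary** (tree-supported weights on `Sym2 (Fin n)`, `o ∉ A`; ancestor lines
`{par^[i] b | i ≤ depth b}`; see `farTreeRow_comb_end` for the hypotheses and `…QuantFarRelayRowComb.lean` for the transfer). [this work] -/
theorem farRelayRow_tree_comb_end (n : ℕ) (w : Sym2 (Fin n) → unitInterval) (o : Fin n)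
    (depth : Fin n → ℕ) (par : Fin n → Fin n)
    (hroot : ∀ x, x ≠ o → depth x = 0 → par x = o)
    (hstep : ∀ x, x ≠ o → depth x ≠ 0 → par x ≠ o ∧ depth (par x) + 1 = depth x)
    (hsupp : ∀ e, w e ≠ 0 → e.IsDiag ∨ ∃ x, x ≠ o ∧ e = s(par x, x))
    (A : Finset (Fin n)) (hoA : o ∉ A) (a : Fin n) (ha : a ∈ A)
    (b₀ : Fin n) (hb₀ : b₀ ∈ A) (hb₀a : b₀ ≠ a)
    (htop : ∀ b ∈ A, b ≠ a →
      (Finset.range (depth b₀ + 1)).image (fun i => par^[i] b₀) ∩ (Finset.range (depth a + 1)).image (fun i => par^[i] a) ⊆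
        (Finset.range (depth b + 1)).image (fun i => par^[i] b) ∩ (Finset.range (depth a + 1)).image (fun i => par^[i] a))
    (hap : (prodBernoulli w).real (openConn o a) ≤
      ∏ y ∈ (Finset.range (depth b₀ + 1)).image (fun i => par^[i] b₀) \ (Finset.range (depth a + 1)).image (fun i => par^[i] a),
        (w s(par y, y) : ℝ))
    (bm : Fin n) (hbm : bm ∈ A) (hθ : ∀ b ∈ A, (prodBernoulli w).real (openConn o bm) ≤ (prodBernoulli w).real (openConn o b))
    (hcomb : ∀ b ∈ A, ∀ b' ∈ A, b ≠ a → b' ≠ a → b ≠ b' →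
      (Finset.range (depth b + 1)).image (fun i => par^[i] b) ∩ (Finset.range (depth b' + 1)).image (fun i => par^[i] b') ⊆
        (Finset.range (depth a + 1)).image (fun i => par^[i] a))
    (j : ℕ) (t : ℝ)
    (hEN : (2 * j : ℝ) < ∑ b ∈ A, (prodBernoulli w).real (openConn o b))
    (ht : ∀ b ∈ A, (prodBernoulli w).real (openConn o b : Set (BondConfig (Fin n)))ᶜ ≤ t) :
    (prodBernoulli w).real {ω : BondConfig (Fin n) | (A.filter fun b => ω ∈ openConn o b).card ≤ j} ≤ t := by
  rw [tree_relayCount_transfer n w o depth par hroot hstep hsupp A j]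
  set q : Fin n → unitInterval := fun x => if x = o then 1 else w s(par x, x) with hq
  set P : Fin n → Finset (Fin n) :=
    fun x => if x = o then {o} else (Finset.range (depth x + 1)).image (fun i => par^[i] x) with hP
  obtain ⟨_, h2, h3⟩ := tree_ancestor_axioms o depth par hstep
  have hAo : ∀ b ∈ A, b ≠ o := fun b hb hbo => hoA (hbo ▸ hb)
  have hPx : ∀ b ∈ A, P b = (Finset.range (depth b + 1)).image (fun i => par^[i] b) := fun b hb => by
    simp only [hP, if_neg (hAo b hb)]
  have hevent : ∀ b, b ≠ o → ∀ ω' : Set (Fin n),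
      (b = o ∨ ∀ i, i ≤ depth b → par^[i] b ∈ ω') ↔ ((P b : Finset (Fin n)) : Set (Fin n)) ⊆ ω' := by
    intro b hbo ω'
    simp only [hbo, false_or, hP, if_neg hbo, Finset.coe_image, Finset.coe_range, Set.image_subset_iff]
    constructor
    · intro h i hi
      exact h i (by simpa [Nat.lt_succ_iff] using hi)
    · intro h i hi
      exact h (show i ∈ Set.Iio (depth b + 1) by simpa [Nat.lt_succ_iff] using hi)
  have hset : {ω' : Set (Fin n) | (A.filter fun b => b = o ∨ ∀ i, i ≤ depth b → par^[i] b ∈ ω').card ≤ j} =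
      {ω' : Set (Fin n) | (A.filter fun b => ((P b : Finset (Fin n)) : Set (Fin n)) ⊆ ω').card ≤ j} := by
    ext ω'
    simp only [Set.mem_setOf_eq]
    rw [Finset.filter_congr fun b hb => hevent b (hAo b hb) ω']
  rw [hset]
  have hmarg : ∀ b ∈ A, ∏ y ∈ P b, (q y : ℝ) = (prodBernoulli w).real (openConn o b) := by
    intro b hb
    have hbo := hAo b hb
    rw [tree_real_openConn_eq_prod n w o depth par hroot hstep hsupp b hbo, hPx b hb,
      Finset.prod_image (tree_iterate_injOn o depth par hstep b hbo)]
    refine Finset.prod_congr rfl fun i hi => ?_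
    have hne := (tree_iterate_par o depth par hstep b hbo i (by have := Finset.mem_range.1 hi; omega)).1
    simp [hq, hne]
  have hEN' : (2 * j : ℝ) < ∑ b ∈ A, ∏ y ∈ P b, (q y : ℝ) := by
    rw [Finset.sum_congr rfl hmarg]; exact hEN
  have ht' : ∀ b ∈ A, 1 - ∏ y ∈ P b, (q y : ℝ) ≤ t := by
    intro b hb
    rw [hmarg b hb, ← probReal_compl_eq_one_sub (Set.toFinite _).measurableSet]
    exact ht b hb
  have hθ' : ∀ b ∈ A, ∏ y ∈ P bm, (q y : ℝ) ≤ ∏ y ∈ P b, (q y : ℝ) := by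
    intro b hb
    rw [hmarg bm hbm, hmarg b hb]
    exact hθ b hb
  have hcomb' : ∀ b ∈ A, ∀ b' ∈ A, b ≠ a → b' ≠ a → b ≠ b' → P b ∩ P b' ⊆ P a := by
    intro b hb b' hb' hba hb'a hbb'
    rw [hPx b hb, hPx b' hb', hPx a ha]
    exact hcomb b hb b' hb' hba hb'a hbb'
  have htop' : ∀ b ∈ A, b ≠ a → P b₀ ∩ P a ⊆ P b ∩ P a := by
    intro b hb hba
    rw [hPx b hb, hPx b₀ hb₀, hPx a ha]
    exact htop b hb hba
  -- the private part of the top hair: gates `q y = w s(par y, y)` (no vertex of it is the root)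
  have hap' : ∏ y ∈ P a, (q y : ℝ) ≤ ∏ y ∈ P b₀ \ P a, (q y : ℝ) := by
    rw [hmarg a ha, hPx b₀ hb₀, hPx a ha]
    refine hap.trans (le_of_eq (Finset.prod_congr rfl fun y hy => ?_))
    have hy' := (Finset.mem_sdiff.1 hy).1
    obtain ⟨i, hi, rfl⟩ := Finset.mem_image.1 hy'
    have hne := (tree_iterate_par o depth par hstep b₀ (hAo b₀ hb₀) i (by have := Finset.mem_range.1 hi; omega)).1
    simp [hq, hne]
  exact farTreeRow_comb_end n P h2 h3 q A j t a ha b₀ hb₀ hb₀a htop' hap' bm hbm hθ' hcomb' hEN' ht'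

end Quant

end Summit.CriticalPhenomena.PercolationContinuityZ3.Theorems

end
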